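import Mathlib.Analysis.Complex.Liouville
import Mathlib.Analysis.Complex.RealDeriv
import Mathlib.Analysis.Convex.Deriv
import Summits.QuantumFields.YangMills.Theorems.BalabanUVNodesN21ChartExponentConvexitySUN

/-!
# N21 (NE7c) · CONVEXITY OF THE [LF-II] (1.2) EXPONENT IS LOCAL: dag-n21-w3 g3's ★★ ∕ ★★′ WITHOUT THE DIAMETER
# BINDER `hdiam : diam K < r` (file 4 of WIDTH-209 N21 piece 2 — Cauchy's estimate for the SECOND derivative along chart lines)

Width seat pub-ymgap-dag-n21-w3 (g4; director-ym №197 ∕ HUMAN RULING D-0149; dag-lead WIDTH-209 N21 piece 2 «CONVEXITY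
of the [LF-II] (1.2) exponent on the chart ⇒ printed-row form of `hφ`», held by this seat since g3), node N21 = NE7c
(single-run shell-weight bound, NOT PRINTED in [Bałaban 1983–89], NOT proved), lane K3⁷ `SpineGivenEndpointR13SepCoPH`
(stmt-QuantumFields-20544, `--kind proof --supports … --as helper`).  Files 1–3 of the piece (g3: p606637
`…N21ChartExponentConvexity`, p607734 `…SUN`, p608893 `…Sanity`) discharge the convexity binder `hφ` of dag-n21-w1's
(M1) ENDs from (1.9) + the structure of (1.2)'s first two members + analyticity of the third-order member `V` on the
complex `r`-balls about the real chart — under a DIAMETER binder `hdiam : ∀ x y ∈ K, ‖y − x‖ < r` (the Schwarz rung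
p591155 §1–§3 bounds ONE global quadratic remainder, so both endpoints must sit in one `r`-ball) and the clauses
`8·d·(100M)^{d+1}·B ≤ γ₀·r²` (oscillation `B`) ∕ `16·d·(100M)^{d+1}·S ≤ γ₀·r²` (value row `S`).  Every consumer displays
`hdiam` today (dag-n21-w1 g2 file 15 p609856 ★, dag-n21-w4 g2 `…RecordAnalytic`, dag-n21-w5 g2 p610142 ★★★).

WHAT (THEOREMS ONLY; 0 `def`, 0 `sorry`).  Convexity is a LOCAL property along segments, so the analyticity radius
need not see the size of the kept cut:
* §1 [textbook] `convexOn_of_convexOn_segments` (segment criterion) · `norm_deriv_deriv_le_of_ball` (Cauchy's estimate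
  for the second derivative in open-ball form: `Φ` ℂ-differentiable on `ball c ρ` with `‖Φ − a‖ ≤ B` there ⇒
  `‖Φ″(c)‖ ≤ 2B∕ρ²` — Mathlib's `Complex.norm_iteratedDeriv_le_of_forall_mem_sphere_norm_le` at `n = 2`, `R ↑ ρ`).
* §2 [textbook] CORE `convexOn_of_lineExpansion_of_locallyAnalytic`: real vector space `V`, real-linear `J : V → W` into
  a complex normed space, `φ = c + ½·Qf + ℓ + Re Φ∘J` on a convex `K`, `Qf` expanding along lines as a quadratic form and
  coercive (`λ·N₂ ≤ Qf`) for a size functional with `‖J v‖² ≤ N₂ v`, `Φ` ℂ-differentiable with `‖Φ − a_x‖ ≤ B` on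
  `ball (J x) r` for EVERY `x ∈ K`, `0 < r`, clause `2B ≤ λ·r²` ⇒ `ConvexOn ℝ K φ`.  Proof: along `t ↦ x + t•h` the
  second derivative is `Qf h + Re G″(t)`, `G w = Φ(J x + w•J h)` holomorphic on the `r∕‖J h‖`-disc about each real
  `t ∈ [0,1]`; §1 gives `‖G″(t)‖ ≤ 2B‖J h‖²∕r² ≤ λ·N₂ h ≤ Qf h`; second-derivative test (`convexOn_of_deriv2_nonneg`,
  `HasDerivAt.real_of_complex`) + segment criterion.
* §3 the flat block frame `κ → ℝ` (`J = ι`, `N₂ v = Σ_b v_b²`, `λ = γ₀∕(2d(100M)^{d+1})` from `Ineq19`):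
  `convexOn_expansion_of_analyticBound_local` (value bound about a centre) and its two readings
  ★★-loc `convexOn_expansion_of_analyticRemainder_local` = p606637 ★★ MINUS `hdiam` (PLUS `0 < r`; clause
  `4·d·(100M)^{d+1}·B ≤ γ₀·r²`, constant 4 instead of 8) and ★★′-loc `convexOn_expansion_of_analyticSupBound_local` =
  p607734 ★★′ (flat) MINUS `hdiam` (clause `4·d·(100M)^{d+1}·S ≤ γ₀·r²`, constant 4 instead of 16: Cauchy is applied to
  `Φ` itself, whose additive constants the second derivative kills — no oscillation doubling).  (`hγ₀ : 0 < γ₀` is no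
  longer needed either.)  The `BlockChartSU N b` readings and the A2 witness are the companion file `…LocalSUN`.
Print's shape is the local one: [LF-II] p. 357 ∕ [B13] Lemma 2 give `V` analytic with a VALUE bound on a complex
neighbourhood of fixed width about the whole real chart — a width that does not grow with the chart; the global device
needed `2R < r` for a kept cut of radius `R`, the local one needs nothing of the kind.

HONEST FRAMING.  [textbook] convex analysis + Cauchy's estimate (Mathlib) over the tree's letters BY NAME; the
identification of (`A`, `ℓ`, `Φ`, `r`, `B`∕`S`) with the members of [LF-II] (1.2) ∕ [B13] Lemma 2 stays LOCATED typing
(desk ME #33∕#34; NODE O's term object), NOT asserted; `hK` (convexity of the kept cut) and the clause stay displayed;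
nothing of Bałaban's asserted; (M1) ∕ NE7c NOT PRINTED ∕ NOT proved; N21 NOT discharged; K3⁷ NOT claimed; counts unmoved
(typed 28∕28 · discharged 5∕27); count-neutral; one finite 𝕋⁴ at fixed ε — the Yang–Mills mass gap (Clay) is NOT proved
by any of this: R4 closes the conditional finite-𝕋⁴ rung `BalabanLadder.UV` only; nothing continuum ∕ ℝ⁴ ∕ OS.
-/

set_option autoImplicit false

noncomputable section

open Set Function Filter Metric Topology
open scoped ENNReal

namespace Summit.QuantumFields.YangMills.Theorems.N21ChartExponentConvexityLocal

/-! ## §1  Textbook: the segment criterion; Cauchy's estimate for the second derivative in its open-ball form -/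

section Textbook

variable {V : Type*} [AddCommGroup V] [Module ℝ V]

/-- **SEGMENT CRITERION.**  A function on a convex set `K` is convex as soon as its restriction
`t ↦ f (x + t • (y − x))` to every segment with endpoints in `K` is convex on `[0, 1]`. [textbook] -/
theorem convexOn_of_convexOn_segments {K : Set V} (hK : Convex ℝ K) {f : V → ℝ}
    (h : ∀ x ∈ K, ∀ y ∈ K, ConvexOn ℝ (Icc (0 : ℝ) 1) fun t : ℝ => f (x + t • (y - x))) :
    ConvexOn ℝ K f := by
  refine ⟨hK, fun x hx y hy a b ha hb hab => ?_⟩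
  have hseg := (h x hx y hy).2 (left_mem_Icc.2 zero_le_one) (right_mem_Icc.2 zero_le_one) ha hb hab
  have h0 : x + (0 : ℝ) • (y - x) = x := by simp
  have h1 : x + (1 : ℝ) • (y - x) = y := by simp
  have hb' : a • (0 : ℝ) + b • (1 : ℝ) = b := by simp
  have hmid : x + b • (y - x) = a • x + b • y := by
    have ha' : a = 1 - b := by linarith
    rw [ha', smul_sub, sub_smul, one_smul]
    abel
  simpa only [hb', h0, h1, hmid] using hseg

/-- **CAUCHY's ESTIMATE FOR THE SECOND DERIVATIVE, OPEN-BALL FORM.**  If `F : ℂ → ℂ` is complex differentiable on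
`ball c ρ` and `‖F w − a‖ ≤ B` there, then `‖F″(c)‖ ≤ 2B∕ρ²` (Mathlib's sphere form
`Complex.norm_iteratedDeriv_le_of_forall_mem_sphere_norm_le` at every radius `R < ρ`, then `R ↑ ρ`). [textbook] -/
theorem norm_deriv_deriv_le_of_ball {F : ℂ → ℂ} {c a : ℂ} {ρ B : ℝ} (hρ : 0 < ρ)
    (hF : DifferentiableOn ℂ F (ball c ρ)) (hB : ∀ w ∈ ball c ρ, ‖F w - a‖ ≤ B) :
    ‖deriv (deriv F) c‖ ≤ 2 * B / ρ ^ 2 := by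
  -- at every radius `R < ρ`
  have key : ∀ R, 0 < R → R < ρ → ‖deriv (deriv F) c‖ ≤ 2 * B / R ^ 2 := by
    intro R hR hRρ
    have hsub : closedBall c R ⊆ ball c ρ := closedBall_subset_ball hRρ
    have hFd : DifferentiableOn ℂ (fun w => -a + F w) (ball c ρ) := hF.const_add (-a)
    have hdc : DiffContOnCl ℂ (fun w => -a + F w) (ball c R) := hFd.diffContOnCl_ball hsub
    have hC : ∀ z ∈ sphere c R, ‖-a + F z‖ ≤ B := fun z hz => by
      rw [neg_add_eq_sub]; exact hB z (hsub (sphere_subset_closedBall hz))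
    have hC2 := Complex.norm_iteratedDeriv_le_of_forall_mem_sphere_norm_le 2 hR hdc hC
    have h2 : iteratedDeriv 2 F = deriv (deriv F) := by
      rw [show (2 : ℕ) = 1 + 1 from rfl, iteratedDeriv_succ, iteratedDeriv_one]
    rw [iteratedDeriv_const_add two_pos, h2, Nat.factorial_two, Nat.cast_ofNat] at hC2
    exact hC2
  -- `R ↑ ρ`
  have hcont : Tendsto (fun R : ℝ => 2 * B / R ^ 2) (𝓝[<] ρ) (𝓝 (2 * B / ρ ^ 2)) :=
    ((continuousAt_const.div (continuousAt_id.pow 2) (pow_ne_zero 2 hρ.ne')).tendsto).mono_left nhdsWithin_le_nhds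
  refine ge_of_tendsto hcont ?_
  filter_upwards [Ioo_mem_nhdsLT (half_lt_self hρ)] with R hR
  exact key R (lt_trans (half_pos hρ) hR.1) hR.2

end Textbook

/-! ## §2  CORE: convexity of `c + ½·Qf + ℓ + Re Φ∘J` from coercivity of `Qf`, LOCAL analyticity of `Φ` with a value
bound about every real point, and one clause — no diameter condition -/

section Core

variable {V : Type*} [AddCommGroup V] [Module ℝ V] {W : Type*} [NormedAddCommGroup W] [NormedSpace ℂ W]

/-- **CORE (diameter-free).**  On a convex `K ⊆ V` let `φ v = c + ½·Qf v + ℓ v + Re Φ(J v)` where `Qf` expands along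
lines as a quadratic form (`Qf (x + t•h) = Qf x + t·cross x h + t²·Qf h`) and is COERCIVE (`λ·N₂ v ≤ Qf v`) w.r.t. a size
functional dominating the complex frame's norm (`‖J v‖² ≤ N₂ v`), `J : V →ₗ[ℝ] W` real-linear into a complex normed space,
and `Φ : W → ℂ` complex differentiable on the `r`-ball about EVERY real point `J x`, `x ∈ K`, with a value bound
`‖Φ − a_x‖ ≤ B` there (`0 < r`).  Then `φ` is convex on `K` as soon as `2B ≤ λ·r²`.  Proof: along the chart line
`t ↦ x + t•h` (`h = y − x`) the second derivative is `Qf h + Re G″(t)`, `G w = Φ(J x + w•J h)` holomorphic on the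
`r∕‖J h‖`-disc about each real `t ∈ [0,1]`; Cauchy (§1) gives `‖G″(t)‖ ≤ 2B‖J h‖²∕r² ≤ 2B·N₂ h∕r² ≤ λ·N₂ h ≤ Qf h`, so the
restriction is convex on `[0,1]` (second-derivative test) and the segment criterion concludes.  No two points of `K` are
ever required to share a ball: the analyticity radius is independent of the size of `K`. [textbook] -/
theorem convexOn_of_lineExpansion_of_locallyAnalytic {K : Set V} (hK : Convex ℝ K) (φ Qf : V → ℝ) (c : ℝ)
    (ℓ : V →ₗ[ℝ] ℝ) (J : V →ₗ[ℝ] W) (Φ : W → ℂ)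
    (hexp : ∀ v ∈ K, φ v = c + 1 / 2 * Qf v + ℓ v + (Φ (J v)).re)
    (cross : V → V → ℝ) (hline : ∀ (x h : V) (t : ℝ), Qf (x + t • h) = Qf x + t * cross x h + t ^ 2 * Qf h)
    (N₂ : V → ℝ) {lam r B : ℝ} (hr : 0 < r) (hcoer : ∀ v, lam * N₂ v ≤ Qf v) (hJ : ∀ v, ‖J v‖ ^ 2 ≤ N₂ v)
    (hΦd : ∀ x ∈ K, DifferentiableOn ℂ Φ (ball (J x) r))
    (hΦB : ∀ x ∈ K, ∃ a : ℂ, ∀ u ∈ ball (J x) r, ‖Φ u - a‖ ≤ B)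
    (hclause : 2 * B ≤ lam * r ^ 2) :
    ConvexOn ℝ K φ := by
  -- `0 ≤ B` (the ball about a point of `K` is inhabited) unless `K = ∅`
  refine convexOn_of_convexOn_segments hK fun x hx y hy => ?_
  obtain ⟨a₀, ha₀⟩ := hΦB x hx
  have hB0 : 0 ≤ B := (norm_nonneg _).trans (ha₀ (J x) (mem_ball_self hr))
  set h : V := y - x with hh
  -- the segment stays in `K`
  have hsegK : ∀ t ∈ Icc (0 : ℝ) 1, x + t • h ∈ K := fun t ht => hK.add_smul_sub_mem hx hy ht
  -- the complex line through `J x` in direction `J h` and the restriction of `Φ` to it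
  set G : ℂ → ℂ := fun w => Φ (J x + w • J h) with hG
  -- the open set of complex parameters within reach of a real point of the segment
  set Ω : Set ℂ := {w | ∃ s ∈ Icc (0 : ℝ) 1, ‖w - (s : ℂ)‖ * ‖J h‖ < r} with hΩ
  have hΩopen : IsOpen Ω := by
    have : Ω = ⋃ s ∈ Icc (0 : ℝ) 1, {w : ℂ | ‖w - (s : ℂ)‖ * ‖J h‖ < r} := by
      ext w; simp [hΩ]
    rw [this]
    exact isOpen_biUnion fun s _ => isOpen_lt (by fun_prop) continuous_const
  have hmemΩ : ∀ s ∈ Icc (0 : ℝ) 1, (s : ℂ) ∈ Ω := fun s hs => ⟨s, hs, by simpa using hr⟩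
  -- `J (x + s•h) = J x + s•J h`, and the line point over `w` is `r`-close to it when `‖w − s‖‖J h‖ < r`
  have hJline : ∀ s : ℝ, J (x + s • h) = J x + (s : ℂ) • J h := fun s => by
    rw [map_add, map_smul, Complex.coe_smul]
  have hclose : ∀ (s : ℝ) (w : ℂ), ‖w - (s : ℂ)‖ * ‖J h‖ < r → J x + w • J h ∈ ball (J (x + s • h)) r := by
    intro s w hw
    rw [mem_ball, dist_eq_norm, hJline, add_sub_add_left_eq_sub, ← sub_smul, norm_smul]
    exact hw
  -- `G` is holomorphic on `Ω`
  have hA : Differentiable ℂ fun w : ℂ => J x + w • J h := (differentiable_id.smul_const (J h)).const_add (J x)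
  have hGd : DifferentiableOn ℂ G Ω := by
    intro w hw
    obtain ⟨s, hs, hws⟩ := hw
    have hΦat : DifferentiableAt ℂ Φ (J x + w • J h) :=
      (hΦd _ (hsegK s hs)).differentiableAt (isOpen_ball.mem_nhds (hclose s w hws))
    exact (hΦat.comp w (hA w)).differentiableWithinAt
  have hGa : ∀ s ∈ Icc (0 : ℝ) 1, AnalyticAt ℂ G (s : ℂ) := fun s hs =>
    hGd.analyticOnNhd hΩopen _ (hmemΩ s hs)
  -- real derivatives of `t ↦ Re G(t)` along the segment
  have hG1 : ∀ s ∈ Icc (0 : ℝ) 1, HasDerivAt (fun t : ℝ => (G t).re) (deriv G s).re s := fun s hs =>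
    (hGa s hs).differentiableAt.hasDerivAt.real_of_complex
  have hG2 : ∀ s ∈ Icc (0 : ℝ) 1, HasDerivAt (fun t : ℝ => (deriv G t).re) (deriv (deriv G) s).re s := fun s hs =>
    (hGa s hs).deriv.differentiableAt.hasDerivAt.real_of_complex
  -- Cauchy: `‖G″(s)‖ ≤ 2B‖J h‖²∕r²` at every real point of the segment
  have hCauchy : ∀ s ∈ Icc (0 : ℝ) 1, ‖deriv (deriv G) s‖ ≤ 2 * B * ‖J h‖ ^ 2 / r ^ 2 := by
    intro s hs
    obtain ⟨a, ha⟩ := hΦB _ (hsegK s hs)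
    rcases eq_or_ne (J h) 0 with hJh | hJh
    · -- degenerate direction: `G` is constant
      have hGc : G = fun _ => Φ (J x) := funext fun w => by simp [hG, hJh]
      rw [hGc, deriv_const', deriv_const, norm_zero, hJh, norm_zero]
      simp
    · have hJpos : 0 < ‖J h‖ := norm_pos_iff.2 hJh
      set ρ : ℝ := r / ‖J h‖ with hρ
      have hρpos : 0 < ρ := div_pos hr hJpos
      have hballΩ : ∀ w ∈ ball (s : ℂ) ρ, ‖w - (s : ℂ)‖ * ‖J h‖ < r := fun w hw => by
        rw [mem_ball, dist_eq_norm] at hw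
        rwa [hρ, lt_div_iff₀ hJpos] at hw
      have hGball : DifferentiableOn ℂ G (ball (s : ℂ) ρ) :=
        hGd.mono fun w hw => ⟨s, hs, hballΩ w hw⟩
      have hGB : ∀ w ∈ ball (s : ℂ) ρ, ‖G w - a‖ ≤ B := fun w hw => ha _ (hclose s w (hballΩ w hw))
      have hC2 := norm_deriv_deriv_le_of_ball hρpos hGball hGB
      calc ‖deriv (deriv G) s‖ ≤ 2 * B / ρ ^ 2 := hC2
        _ = 2 * B * ‖J h‖ ^ 2 / r ^ 2 := by rw [hρ, div_pow, div_div_eq_mul_div]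
  -- the model of the restriction: polynomial part + `Re G`
  set P : ℝ → ℝ := fun t => c + 1 / 2 * (Qf x + t * cross x h + t ^ 2 * Qf h) + (ℓ x + t * ℓ h) with hP
  set P₁ : ℝ → ℝ := fun t => 1 / 2 * (cross x h + 2 * t * Qf h) + ℓ h with hP₁
  have hPd : ∀ t, HasDerivAt P (P₁ t) t := by
    intro t
    have h1 : HasDerivAt (fun t : ℝ => t * cross x h) (1 * cross x h) t := (hasDerivAt_id' t).mul_const _
    have h2 : HasDerivAt (fun t : ℝ => t ^ 2 * Qf h) ((2 : ℕ) * t ^ (2 - 1) * Qf h) t :=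
      (hasDerivAt_pow 2 t).mul_const _
    have h3 : HasDerivAt (fun t : ℝ => t * ℓ h) (1 * ℓ h) t := (hasDerivAt_id' t).mul_const _
    have h4 : HasDerivAt (fun t : ℝ => c + 1 / 2 * (Qf x + t * cross x h + t ^ 2 * Qf h) + (ℓ x + t * ℓ h))
        (1 / 2 * (1 * cross x h + (2 : ℕ) * t ^ (2 - 1) * Qf h) + 1 * ℓ h) t :=
      ((((h1.const_add (Qf x)).add h2).const_mul (1 / 2)).const_add c).add (h3.const_add (ℓ x))
    exact h4.congr_deriv (by norm_num [hP₁])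
  have hP₁d : ∀ t, HasDerivAt P₁ (Qf h) t := by
    intro t
    have h1 : HasDerivAt (fun t : ℝ => 2 * t * Qf h) (2 * 1 * Qf h) t :=
      ((hasDerivAt_id' t).const_mul 2).mul_const _
    have h4 : HasDerivAt (fun t : ℝ => 1 / 2 * (cross x h + 2 * t * Qf h) + ℓ h) (1 / 2 * (2 * 1 * Qf h) + 0) t :=
      ((h1.const_add (cross x h)).const_mul (1 / 2)).add (hasDerivAt_const t (ℓ h))
    exact h4.congr_deriv (by ring)
  set gm : ℝ → ℝ := fun t => P t + (G t).re with hgm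
  set gm₁ : ℝ → ℝ := fun t => P₁ t + (deriv G t).re with hgm₁
  set gm₂ : ℝ → ℝ := fun t => Qf h + (deriv (deriv G) t).re with hgm₂
  have hgmd : ∀ s ∈ Icc (0 : ℝ) 1, HasDerivAt gm (gm₁ s) s := fun s hs => (hPd s).add (hG1 s hs)
  have hgm₁d : ∀ s ∈ Icc (0 : ℝ) 1, HasDerivAt gm₁ (gm₂ s) s := fun s hs => (hP₁d s).add (hG2 s hs)
  -- the second derivative is nonnegative: `Qf h ≥ λ N₂ h ≥ 2B N₂ h ∕ r² ≥ 2B‖J h‖²∕r² ≥ |Re G″|`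
  have hgm₂pos : ∀ s ∈ Icc (0 : ℝ) 1, 0 ≤ gm₂ s := by
    intro s hs
    have hN : ‖J h‖ ^ 2 ≤ N₂ h := hJ h
    have hN0 : 0 ≤ N₂ h := (sq_nonneg _).trans hN
    have hre : -(‖deriv (deriv G) s‖) ≤ (deriv (deriv G) s).re :=
      (abs_le.1 (Complex.abs_re_le_norm _)).1
    have hC := hCauchy s hs
    have hr2 : 0 < r ^ 2 := pow_pos hr 2
    have h1 : 2 * B * ‖J h‖ ^ 2 / r ^ 2 ≤ 2 * B * N₂ h / r ^ 2 :=
      div_le_div_of_nonneg_right (mul_le_mul_of_nonneg_left hN (mul_nonneg two_pos.le hB0)) hr2.le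
    have h2 : 2 * B * N₂ h / r ^ 2 ≤ lam * N₂ h := by
      rw [div_le_iff₀ hr2]
      calc 2 * B * N₂ h = 2 * B * N₂ h := rfl
        _ ≤ lam * r ^ 2 * N₂ h := mul_le_mul_of_nonneg_right hclause hN0
        _ = lam * N₂ h * r ^ 2 := by ring
    have h3 := hcoer h
    simp only [hgm₂]
    linarith
  -- the model is convex on `[0,1]` by the second-derivative test
  have hconv : ConvexOn ℝ (Icc (0 : ℝ) 1) gm := by
    have hint : interior (Icc (0 : ℝ) 1) = Ioo 0 1 := interior_Icc
    refine convexOn_of_deriv2_nonneg (convex_Icc 0 1) ?_ ?_ ?_ ?_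
    · exact fun s hs => (hgmd s hs).continuousAt.continuousWithinAt
    · rw [hint]; exact fun s hs => (hgmd s (Ioo_subset_Icc_self hs)).differentiableAt.differentiableWithinAt
    · rw [hint]
      intro s hs
      have hev : deriv gm =ᶠ[𝓝 s] gm₁ := by
        filter_upwards [Ioo_mem_nhds hs.1 hs.2] with t ht using (hgmd t (Ioo_subset_Icc_self ht)).deriv
      exact ((hgm₁d s (Ioo_subset_Icc_self hs)).differentiableAt.congr_of_eventuallyEq hev).differentiableWithinAt
    · rw [hint]
      intro s hs
      have hev : deriv gm =ᶠ[𝓝 s] gm₁ := by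
        filter_upwards [Ioo_mem_nhds hs.1 hs.2] with t ht using (hgmd t (Ioo_subset_Icc_self ht)).deriv
      show 0 ≤ deriv (deriv gm) s
      rw [hev.deriv_eq, (hgm₁d s (Ioo_subset_Icc_self hs)).deriv]
      exact hgm₂pos s (Ioo_subset_Icc_self hs)
  -- the model IS the restriction of `φ` on `[0,1]`
  refine hconv.congr fun t ht => ?_
  have hmem := hsegK t ht
  simp only [hgm, hP, hG]
  rw [hexp _ hmem, hline, map_add, map_smul, smul_eq_mul, hJline]

end Core

/-! ## §3  The flat block frame `κ → ℝ`: g3's ★★ ∕ ★★′ (p606637 ∕ p607734) WITHOUT `hdiam` -/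

section Flat

open Matrix
open Literature.MathematicalPhysics.QuantumFieldTheory.Balaban1983to89.B16Sect1Wilson (Ineq19)
open Summit.QuantumFields.YangMills.Theorems.N21LowCentreNumeralBlock (sq_pi_norm_le_sum_sq)
open Summit.QuantumFields.YangMills.Theorems.N21AnalyticResponseRemainder (norm_realToComplex_pi)

variable {κ : Type*} [Fintype κ]

/-- **LOCAL FORM, flat frame, value bound about a centre.**  On a convex `K ⊆ (κ → ℝ)` let
`φ v = c + ½·Qf v + lin v + Vt v` with `Qf v = v ⬝ᵥ (A *ᵥ v)`, (1.9) `Ineq19 (Qf v) (Σ_b v_b²) γ₀ d M` for every `v`,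
`lin = ⇑ℓ`, `Vt = Re Φ∘ι` on `K` with `Φ` complex differentiable on the (sup-norm) `r`-ball about every real point `ι x`,
`x ∈ K`, and bounded there about some centre, `‖Φ u − a_x‖ ≤ B` (`0 < r`).  Then `ConvexOn ℝ K φ` under
`4·d·(100M)^{d+1}·B ≤ γ₀·r²` — NO condition relating `r` to the size of `K`. (§2 at `J = ι`, `N₂ v = Σ_b v_b²`,
`λ = γ₀∕(2d(100M)^{d+1})`.) [textbook] -/
theorem convexOn_expansion_of_analyticBound_local {K : Set (κ → ℝ)} (hK : Convex ℝ K)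
    (φ Qf lin Vt : (κ → ℝ) → ℝ) (c : ℝ) (hexp : ∀ v ∈ K, φ v = c + 1 / 2 * Qf v + lin v + Vt v)
    (A : Matrix κ κ ℝ) (hQf : ∀ v, Qf v = v ⬝ᵥ (A *ᵥ v))
    {γ₀ M : ℝ} {d : ℕ} (hd : 1 ≤ d) (hM : 0 < M)
    (h19 : ∀ v, Ineq19 (Qf v) (∑ b, v b ^ 2) γ₀ d M)
    (ℓ : (κ → ℝ) →ₗ[ℝ] ℝ) (hlin : ∀ v, lin v = ℓ v)
    (Φ : (κ → ℂ) → ℂ) {r B : ℝ} (hr : 0 < r) (hVt : ∀ x ∈ K, Vt x = (Φ fun i => (x i : ℂ)).re)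
    (hΦd : ∀ x ∈ K, DifferentiableOn ℂ Φ (ball (fun i => (x i : ℂ)) r))
    (hΦB : ∀ x ∈ K, ∃ a : ℂ, ∀ u ∈ ball (fun i => (x i : ℂ)) r, ‖Φ u - a‖ ≤ B)
    (hclause : 4 * d * (100 * M) ^ (d + 1) * B ≤ γ₀ * r ^ 2) :
    ConvexOn ℝ K φ := by
  -- the real-linear complexification `ι` of the block frame
  let J : (κ → ℝ) →ₗ[ℝ] (κ → ℂ) :=
    { toFun := fun x i => (x i : ℂ)
      map_add' := fun x y => by ext i; simp
      map_smul' := fun a x => by ext i; simp }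
  have hJ : ∀ v, J v = fun i => (v i : ℂ) := fun v => rfl
  have hd0 : (0 : ℝ) < d := by exact_mod_cast hd
  set D : ℝ := 2 * d * (100 * M) ^ (d + 1) with hD
  have hDpos : 0 < D := by positivity
  refine convexOn_of_lineExpansion_of_locallyAnalytic hK φ Qf c ℓ J Φ (fun v hv => ?_)
    (fun x h => x ⬝ᵥ (A *ᵥ h) + h ⬝ᵥ (A *ᵥ x)) (fun x h t => ?_) (fun v => ∑ b, v b ^ 2) (lam := γ₀ / D) hr
    (fun v => ?_) (fun v => ?_) (fun x hx => by rw [hJ]; exact hΦd x hx) (fun x hx => by rw [hJ]; exact hΦB x hx) ?_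
  · rw [hexp v hv, hlin v, hVt v hv, hJ]
  · rw [hQf, hQf, hQf]
    simp only [mulVec_add, mulVec_smul, dotProduct_add, add_dotProduct, dotProduct_smul, smul_dotProduct, smul_eq_mul]
    ring
  · have := h19 v
    unfold Ineq19 at this
    simpa [hD] using this
  · rw [hJ, norm_realToComplex_pi]; exact sq_pi_norm_le_sum_sq v
  · rw [div_mul_eq_mul_div, le_div_iff₀ hDpos]
    calc 2 * B * D = 4 * d * (100 * M) ^ (d + 1) * B := by rw [hD]; ring
      _ ≤ γ₀ * r ^ 2 := hclause

/-- ★★-loc **g3's ★★ `convexOn_expansion_of_analyticRemainder` WITHOUT `hdiam`** (oscillation letter `B`: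
`Φ(ball) ⊆ closedBall (Φ(ι x)) B`): `ConvexOn ℝ K φ` under `0 < r` and `4·d·(100M)^{d+1}·B ≤ γ₀·r²` (constant 4, was 8;
the analyticity radius is independent of `diam K`). [textbook] -/
theorem convexOn_expansion_of_analyticRemainder_local {K : Set (κ → ℝ)} (hK : Convex ℝ K)
    (φ Qf lin Vt : (κ → ℝ) → ℝ) (c : ℝ) (hexp : ∀ v ∈ K, φ v = c + 1 / 2 * Qf v + lin v + Vt v)
    (A : Matrix κ κ ℝ) (hQf : ∀ v, Qf v = v ⬝ᵥ (A *ᵥ v))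
    {γ₀ M : ℝ} {d : ℕ} (hd : 1 ≤ d) (hM : 0 < M)
    (h19 : ∀ v, Ineq19 (Qf v) (∑ b, v b ^ 2) γ₀ d M)
    (ℓ : (κ → ℝ) →ₗ[ℝ] ℝ) (hlin : ∀ v, lin v = ℓ v)
    (Φ : (κ → ℂ) → ℂ) {r B : ℝ} (hr : 0 < r) (hVt : ∀ x ∈ K, Vt x = (Φ fun i => (x i : ℂ)).re)
    (hΦd : ∀ x ∈ K, DifferentiableOn ℂ Φ (ball (fun i => (x i : ℂ)) r))
    (hΦB : ∀ x ∈ K, MapsTo Φ (ball (fun i => (x i : ℂ)) r) (closedBall (Φ fun i => (x i : ℂ)) B))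
    (hclause : 4 * d * (100 * M) ^ (d + 1) * B ≤ γ₀ * r ^ 2) :
    ConvexOn ℝ K φ :=
  convexOn_expansion_of_analyticBound_local hK φ Qf lin Vt c hexp A hQf hd hM h19 ℓ hlin Φ hr hVt hΦd
    (fun x hx => ⟨Φ fun i => (x i : ℂ), fun u hu => by
      have := hΦB x hx hu
      rwa [mem_closedBall, dist_eq_norm] at this⟩) hclause

/-- ★★′-loc **g3's ★★′ `convexOn_expansion_of_analyticSupBound` WITHOUT `hdiam`** (value row `‖Φ‖ ≤ S` on the
complex `r`-balls about the real points of `K` — print's shape, [LF-II] p. 357 ∕ [B13] (1.36)): `ConvexOn ℝ K φ` under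
`0 < r` and `4·d·(100M)^{d+1}·S ≤ γ₀·r²` (constant 4, was 16; Cauchy applied to `Φ` itself — constants are killed by
the second derivative, so no oscillation doubling). [textbook] -/
theorem convexOn_expansion_of_analyticSupBound_local {K : Set (κ → ℝ)} (hK : Convex ℝ K)
    (φ Qf lin Vt : (κ → ℝ) → ℝ) (c : ℝ) (hexp : ∀ v ∈ K, φ v = c + 1 / 2 * Qf v + lin v + Vt v)
    (A : Matrix κ κ ℝ) (hQf : ∀ v, Qf v = v ⬝ᵥ (A *ᵥ v))
    {γ₀ M : ℝ} {d : ℕ} (hd : 1 ≤ d) (hM : 0 < M)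
    (h19 : ∀ v, Ineq19 (Qf v) (∑ b, v b ^ 2) γ₀ d M)
    (ℓ : (κ → ℝ) →ₗ[ℝ] ℝ) (hlin : ∀ v, lin v = ℓ v)
    (Φ : (κ → ℂ) → ℂ) {r S : ℝ} (hr : 0 < r) (hVt : ∀ x ∈ K, Vt x = (Φ fun i => (x i : ℂ)).re)
    (hΦd : ∀ x ∈ K, DifferentiableOn ℂ Φ (ball (fun i => (x i : ℂ)) r))
    (hΦS : ∀ x ∈ K, ∀ u ∈ ball (fun i => (x i : ℂ)) r, ‖Φ u‖ ≤ S)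
    (hclause : 4 * d * (100 * M) ^ (d + 1) * S ≤ γ₀ * r ^ 2) :
    ConvexOn ℝ K φ :=
  convexOn_expansion_of_analyticBound_local hK φ Qf lin Vt c hexp A hQf hd hM h19 ℓ hlin Φ hr hVt hΦd
    (fun x hx => ⟨0, fun u hu => by rw [sub_zero]; exact hΦS x hx u hu⟩) hclause

end Flat

end Summit.QuantumFields.YangMills.Theorems.N21ChartExponentConvexityLocal

end
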